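import Summits.Langlands.Langlands.Theses.DescentTypeTrichotomy

/-!
# Glue of the layer-2 split of `InsolvableTypeAutomorphy` (route DescentTypeTrichotomy, rev 1)

Closes the glue item `stmt-Langlands-29576` of `route-Langlands-DescentTypeTrichotomy`:
`InsolvableTypeAutomorphy_of_split :
  InsolvableBaseChangeAutomorphy → PrimitiveTypeAutomorphy → InsolvableTypeAutomorphy`.
Pure logic — excluded middle on the (inlined) second dial PSAT(K, ρ) «ρ is potentially of
TR/CM type»: an instance of the generic cell GEN (¬SAT) that satisfies PSAT is handled by
`InsolvableBaseChangeAutomorphy` (DESC, which also receives ¬SAT), one that fails PSAT by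
`PrimitiveTypeAutomorphy` (PRIM).  This is the lens-2 node proof
`DescentTypeTrichotomy.insolvableTypeAutomorphy_of_split_proof` (decomp-langlands, 2026-08-30;
certified against the gate render of the split and, by the critic, against the route of record by
`Iff.rfl`), transported to the tree's declarations.  No definitions, no new mathematics.
-/

set_option linter.dupNamespace false -- project-wide option; `Summit.Langlands.Langlands` is the mandated namespace

namespace Summit.Langlands.Langlands.Theorems

open Summit.Langlands.Langlands.Theses in
/-- The glue item `stmt-Langlands-29576` of route DescentTypeTrichotomy (rev 1): the two children
`InsolvableBaseChangeAutomorphy` (DESC) and `PrimitiveTypeAutomorphy` (PRIM) of the split of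
`InsolvableTypeAutomorphy` (GEN) imply the parent.  Proof: by cases on the second dial
PSAT(K, ρ) — «∃ a totally real or CM K₀, a number field M ⊇ K, K₀ with M/K of solvable Galois
closure, and an irreducible pinned-geometric Lie-irreducible ρ₀ over K₀ twist-matching ρ on Γ_M»;
the PSAT case is DESC (fed the ambient ¬SAT), the ¬PSAT case is PRIM. -/
theorem InsolvableTypeAutomorphy_of_split_proof :
    Summit.Langlands.Langlands.Theses.DescentTypeTrichotomy.InsolvableTypeAutomorphy_of_split := by
  intro hDESC hPRIM K _ _ n hcpt hn ℓ _ ι ρ hirr hgeo hLie hns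
  by_cases hps : (∃ (K₀ : Type) (_ : Field K₀) (_ : NumberField K₀) (M : Type) (_ : Field M)
      (_ : NumberField M) (_ : Algebra K M) (_ : Algebra K₀ M),
      (NumberField.IsTotallyReal K₀ ∨ NumberField.IsCMField K₀) ∧
      (∃ (N : Type) (_ : Field N) (_ : NumberField N) (_ : Algebra K N) (_ : Algebra M N)
        (_ : IsScalarTower K M N), IsGalois K N ∧ IsSolvable (N ≃ₐ[K] N)) ∧
      ∃ ρ₀ : Literature.NumberTheory.GaloisRepresentations.FramedGaloisRep K₀ (PadicAlgCl ℓ) n,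
        ρ₀.toGaloisRep.IsIrreducible ∧
        ((∀ᶠ v : IsDedekindDomain.HeightOneSpectrum (NumberField.RingOfIntegers K₀) in
            Filter.cofinite, ρ₀.IsUnramifiedAt v) ∧
          ∀ (v : IsDedekindDomain.HeightOneSpectrum (NumberField.RingOfIntegers K₀))
            (hv : ((ℓ : ℕ) : NumberField.RingOfIntegers K₀) ∈ v.asIdeal),
            (Literature.NumberTheory.PAdicHodge.fontainePstAdicCompletion v ℓ hv).IsDeRhamFramed
              (ρ₀.toLocal v)) ∧
        (∀ (L : Type) [Field L] [NumberField L] [Algebra K₀ L],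
          (ρ₀.restrictField L).toGaloisRep.IsIrreducible) ∧
        ∀ g : Field.absoluteGaloisGroup M, ∃ c : PadicAlgCl ℓ, c ≠ 0 ∧
          Literature.NumberTheory.GaloisRepresentations.FramedRep.charpoly (ρ.restrictField M) g =
            (Literature.NumberTheory.GaloisRepresentations.FramedRep.charpoly
              (ρ₀.restrictField M) g).scaleRoots c)
  · exact hDESC K n hcpt hn ℓ ι ρ hirr hgeo hLie hps hns
  · exact hPRIM K n hcpt hn ℓ ι ρ hirr hgeo hLie hps

end Summit.Langlands.Langlands.Theorems
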